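import Summits.PneNP.PneNP.Theorems.KarlinRubinMonotoneSufficesTransportPerm

/-!
# Crux `MonotoneSuffices` (stmt-PneNP-18026), line `slice-transport` — stub `stub_transport`, part 2:
# deleting the lowest-ranked `d` present coordinates maps a slice uniformly onto a lower slice

Generic counting on the cube `α → Bool` over a finite type `α` (`supp x = {a | x a}`, slices
`{x | #supp x = j}`), with a PROTECTED set `K ⊆ supp x` (the planted clique's edges; `K = ∅` for
the null law). Deleting a `d`-set `D ⊆ supp x \ K` from `x` (`x ⊖ D`) is, on pairs `(x, D)`, a
bijection onto the pairs `(y, D)` with `#supp y = #supp x - d`, `K ⊆ supp y`, `D ∩ supp y = ∅`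
(`sum_slice_sum_powersetCard_del`); combined with the equidistribution of part 1
(`sum_lowest_mul_choose`), averaging over all rankings `σ` of the deletion of the `d` LOWEST-RANKED
present coordinates gives (`transport_counting_good`)
`(∑_σ ∑_{x : #supp x = m, K ⊆ supp x} 𝟙[lowest ∩ K = ∅] F(x ⊖ lowest)) · C(m,d)
   = #rankings · C(N-(m-d), d) · ∑_{y : #supp y = m-d, K ⊆ supp y} F y`,
and the bad event `lowest ∩ K ≠ ∅` is counted exactly (`transport_counting_bad`):
`(#{σ | lowest ∩ K ≠ ∅}) · C(m,d) = #rankings · (C(m,d) - C(m-#K, d))` for each such `x`.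
-/

set_option linter.dupNamespace false -- `Summit.PneNP.PneNP.…`: summit = sub-problem name (D-0017 single-conjunct layout)

namespace Summit.PneNP.PneNP.Theorems.MonotoneSuffices.SliceTransport

open Finset

variable {α : Type*} [Fintype α] [DecidableEq α]

/-! ### Support, deletion, insertion -/

/-- Support of a deletion: `supp (x ⊖ D) = supp x \ D`. [folklore] -/
theorem filter_del_eq (x : α → Bool) (D : Finset α) :
    (univ.filter fun a => (x a && !decide (a ∈ D)) = true) = (univ.filter fun a => x a = true) \ D := by
  ext a
  simp only [mem_filter, mem_univ, true_and, mem_sdiff, Bool.and_eq_true, Bool.not_eq_true',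
    decide_eq_false_iff_not]

/-- Support of an insertion: `supp (y ⊕ D) = supp y ∪ D`. [folklore] -/
theorem filter_ins_eq (y : α → Bool) (D : Finset α) :
    (univ.filter fun a => (y a || decide (a ∈ D)) = true) = (univ.filter fun a => y a = true) ∪ D := by
  ext a
  simp only [mem_filter, mem_univ, true_and, mem_union, Bool.or_eq_true, decide_eq_true_eq]

/-- Re-inserting a deleted set contained in the support restores the vector. [folklore] -/
theorem ins_del_of_subset {x : α → Bool} {D : Finset α} (hD : D ⊆ univ.filter fun a => x a = true) :
    (fun a => ((x a && !decide (a ∈ D)) || decide (a ∈ D))) = x := by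
  funext a
  by_cases ha : a ∈ D
  · have hxa : x a = true := (mem_filter.1 (hD ha)).2
    simp [ha, hxa]
  · simp [ha]

/-- Deleting an inserted set disjoint from the support restores the vector. [folklore] -/
theorem del_ins_of_disjoint {y : α → Bool} {D : Finset α}
    (hD : D ⊆ univ \ univ.filter fun a => y a = true) :
    (fun a => ((y a || decide (a ∈ D)) && !decide (a ∈ D))) = y := by
  funext a
  by_cases ha : a ∈ D
  · have hya : ¬ y a = true := fun h => (mem_sdiff.1 (hD ha)).2 (mem_filter.2 ⟨mem_univ _, h⟩)
    have hya' : y a = false := by simpa using hya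
    simp [ha, hya']
  · simp [ha]

/-! ### The deletion bijection between slices -/

/-- **Deletion of a `d`-subset of the unprotected support is a bijection between slice pairs**:
summing `F (x ⊖ D)` over `x` with `#supp x = m`, `K ⊆ supp x` and `D ∈ powersetCard d (supp x \ K)`
equals `C(N - (m - d), d) · ∑ F y` over `y` with `#supp y = m - d`, `K ⊆ supp y` (`d ≤ m`;
`N = |α|`). [folklore] -/
theorem sum_slice_sum_powersetCard_del (K : Finset α) {m d : ℕ} (hd : d ≤ m) (F : (α → Bool) → ℝ) :
    ∑ x ∈ (univ : Finset (α → Bool)).filter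
        (fun x => #(univ.filter fun a => x a = true) = m ∧ K ⊆ univ.filter fun a => x a = true),
      ∑ D ∈ ((univ.filter fun a => x a = true) \ K).powersetCard d,
        F (fun a => x a && !decide (a ∈ D)) =
    ((Fintype.card α - (m - d)).choose d : ℝ) *
      ∑ y ∈ (univ : Finset (α → Bool)).filter
        (fun y => #(univ.filter fun a => y a = true) = m - d ∧ K ⊆ univ.filter fun a => y a = true), F y := by
  classical
  -- both sides as sums over sigma-finsets of pairs
  set X : Finset (α → Bool) := univ.filter
    (fun x => #(univ.filter fun a => x a = true) = m ∧ K ⊆ univ.filter fun a => x a = true) with hX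
  set Y : Finset (α → Bool) := univ.filter
    (fun y => #(univ.filter fun a => y a = true) = m - d ∧ K ⊆ univ.filter fun a => y a = true) with hY
  set TX : (α → Bool) → Finset (Finset α) := fun x => ((univ.filter fun a => x a = true) \ K).powersetCard d
    with hTX
  set TY : (α → Bool) → Finset (Finset α) := fun y => (univ \ univ.filter fun a => y a = true).powersetCard d
    with hTY
  have rhs : ((Fintype.card α - (m - d)).choose d : ℝ) * ∑ y ∈ Y, F y = ∑ y ∈ Y, ∑ _D ∈ TY y, F y := by
    rw [mul_sum]
    refine sum_congr rfl fun y hy => ?_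
    have hyc : #(univ.filter fun a => y a = true) = m - d := (mem_filter.1 hy).2.1
    rw [sum_const, nsmul_eq_mul, hTY]
    simp only
    rw [card_powersetCard, card_sdiff_of_subset (subset_univ _), card_univ, hyc]
  change ∑ x ∈ X, ∑ D ∈ TX x, F (fun a => x a && !decide (a ∈ D)) = _
  rw [rhs, sum_sigma', sum_sigma']
  -- the bijection `(x, D) ↦ (x ⊖ D, D)` with inverse `(y, D) ↦ (y ⊕ D, D)`
  refine sum_bij' (fun p _ => (⟨fun a => p.1 a && !decide (a ∈ p.2), p.2⟩ : Σ _ : α → Bool, Finset α))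
    (fun q _ => (⟨fun a => q.1 a || decide (a ∈ q.2), q.2⟩ : Σ _ : α → Bool, Finset α)) ?_ ?_ ?_ ?_ ?_
  · -- maps into the target
    rintro ⟨x, D⟩ hp
    rw [mem_sigma] at hp ⊢
    obtain ⟨hx, hDm⟩ := hp
    rw [hX, mem_filter] at hx
    obtain ⟨-, hxm, hKx⟩ := hx
    simp only [hTX, mem_powersetCard] at hDm
    obtain ⟨hDsub, hDcard⟩ := hDm
    have hDx : D ⊆ univ.filter fun a => x a = true := hDsub.trans sdiff_subset
    refine ⟨?_, ?_⟩
    · rw [hY, mem_filter]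
      refine ⟨mem_univ _, ?_, ?_⟩
      · simp only
        rw [filter_del_eq, card_sdiff_of_subset hDx, hxm, hDcard]
      · simp only
        rw [filter_del_eq]
        intro a ha
        rw [mem_sdiff]
        exact ⟨hKx ha, fun haD => (mem_sdiff.1 (hDsub haD)).2 ha⟩
    · simp only [hTY, mem_powersetCard]
      refine ⟨?_, hDcard⟩
      rw [filter_del_eq]
      intro a ha
      rw [mem_sdiff]
      exact ⟨mem_univ _, fun h => (mem_sdiff.1 h).2 ha⟩
  · -- inverse maps into the source
    rintro ⟨y, D⟩ hq
    rw [mem_sigma] at hq ⊢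
    obtain ⟨hy, hDm⟩ := hq
    rw [hY, mem_filter] at hy
    obtain ⟨-, hym, hKy⟩ := hy
    simp only [hTY, mem_powersetCard] at hDm
    obtain ⟨hDsub, hDcard⟩ := hDm
    have hdisj : Disjoint (univ.filter fun a => y a = true) D := by
      rw [disjoint_right]
      intro a ha h
      exact (mem_sdiff.1 (hDsub ha)).2 h
    refine ⟨?_, ?_⟩
    · rw [hX, mem_filter]
      refine ⟨mem_univ _, ?_, ?_⟩
      · simp only
        rw [filter_ins_eq, card_union_of_disjoint hdisj, hym, hDcard]
        omega
      · simp only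
        rw [filter_ins_eq]
        exact hKy.trans subset_union_left
    · simp only [hTX, mem_powersetCard]
      refine ⟨?_, hDcard⟩
      rw [filter_ins_eq]
      intro a ha
      rw [mem_sdiff, mem_union]
      refine ⟨Or.inr ha, fun haK => ?_⟩
      exact (mem_sdiff.1 (hDsub ha)).2 (hKy haK)
  · -- left inverse
    rintro ⟨x, D⟩ hp
    rw [mem_sigma] at hp
    obtain ⟨-, hDm⟩ := hp
    simp only [hTX, mem_powersetCard] at hDm
    have hDx : D ⊆ univ.filter fun a => x a = true := hDm.1.trans sdiff_subset
    exact Sigma.ext (ins_del_of_subset hDx) (heq_of_eq rfl)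
  · -- right inverse
    rintro ⟨y, D⟩ hq
    rw [mem_sigma] at hq
    obtain ⟨-, hDm⟩ := hq
    simp only [hTY, mem_powersetCard] at hDm
    exact Sigma.ext (del_ins_of_disjoint hDm.1) (heq_of_eq rfl)
  · -- the summands agree
    rintro ⟨x, D⟩ _
    rfl

/-! ### Averaging over rankings -/

/-- **Good part of the transport, counted exactly.** Summing, over all rankings `σ` and all `x`
with `#supp x = m ⊇ K`, the value `F (x ⊖ lowest_d(σ, supp x))` on the event that the deleted set
avoids `K`, and multiplying by `C(m,d)`, gives
`#rankings · C(N-(m-d), d) · ∑_{y : #supp y = m-d, K ⊆ supp y} F y` (`d ≤ m`). [folklore] -/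
theorem transport_counting_good (K : Finset α) {m d : ℕ} (hd : d ≤ m) (F : (α → Bool) → ℝ) :
    (∑ σ : α ≃ Fin (Fintype.card α),
      ∑ x ∈ (univ : Finset (α → Bool)).filter
        (fun x => #(univ.filter fun a => x a = true) = m ∧ K ⊆ univ.filter fun a => x a = true),
        (if Disjoint ((univ.filter fun a => x a = true).filter fun a =>
              #((univ.filter fun a => x a = true).filter fun c => σ c < σ a) < d) K
          then F (fun a => x a && !decide (a ∈ (univ.filter fun a => x a = true).filter fun a =>
              #((univ.filter fun a => x a = true).filter fun c => σ c < σ a) < d))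
          else 0)) * (m.choose d : ℝ) =
    (Fintype.card (α ≃ Fin (Fintype.card α)) : ℝ) * ((Fintype.card α - (m - d)).choose d : ℝ) *
      ∑ y ∈ (univ : Finset (α → Bool)).filter
        (fun y => #(univ.filter fun a => y a = true) = m - d ∧ K ⊆ univ.filter fun a => y a = true), F y := by
  classical
  rw [sum_comm, sum_mul]
  -- pointwise in `x`: equidistribution, then restriction to the `d`-subsets avoiding `K`
  have hx : ∀ x ∈ (univ : Finset (α → Bool)).filter
      (fun x => #(univ.filter fun a => x a = true) = m ∧ K ⊆ univ.filter fun a => x a = true),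
      (∑ σ : α ≃ Fin (Fintype.card α),
        (if Disjoint ((univ.filter fun a => x a = true).filter fun a =>
              #((univ.filter fun a => x a = true).filter fun c => σ c < σ a) < d) K
          then F (fun a => x a && !decide (a ∈ (univ.filter fun a => x a = true).filter fun a =>
              #((univ.filter fun a => x a = true).filter fun c => σ c < σ a) < d))
          else 0)) * (m.choose d : ℝ) =
      (Fintype.card (α ≃ Fin (Fintype.card α)) : ℝ) *
        ∑ D ∈ ((univ.filter fun a => x a = true) \ K).powersetCard d, F (fun a => x a && !decide (a ∈ D)) := by
    intro x hxm
    have hxc : #(univ.filter fun a => x a = true) = m := (mem_filter.1 hxm).2.1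
    have h := sum_lowest_mul_choose (univ.filter fun a => x a = true) (d := d) (by rw [hxc]; exact hd)
      (fun D => if Disjoint D K then F (fun a => x a && !decide (a ∈ D)) else 0)
    rw [hxc] at h
    rw [h]
    congr 1
    rw [← sum_filter]
    refine sum_congr ?_ fun D _ => rfl
    ext D
    simp only [mem_filter, mem_powersetCard, subset_sdiff, and_comm, and_left_comm]
  rw [sum_congr rfl hx, ← mul_sum, sum_slice_sum_powersetCard_del K hd F, mul_assoc]

/-- **Bad part of the transport, counted exactly.** For `x` with `#supp x = m ⊇ K`, the number of
rankings whose `d` lowest-ranked present coordinates meet `K`, times `C(m,d)`, is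
`#rankings · (C(m,d) - C(m - #K, d))` (`d ≤ m`). [folklore] -/
theorem transport_counting_bad (K : Finset α) {m d : ℕ} (hd : d ≤ m) (x : α → Bool)
    (hxm : #(univ.filter fun a => x a = true) = m) (hK : K ⊆ univ.filter fun a => x a = true) :
    (#((univ : Finset (α ≃ Fin (Fintype.card α))).filter fun σ =>
        ¬ Disjoint ((univ.filter fun a => x a = true).filter fun a =>
            #((univ.filter fun a => x a = true).filter fun c => σ c < σ a) < d) K) : ℝ) * (m.choose d : ℝ) =
    (Fintype.card (α ≃ Fin (Fintype.card α)) : ℝ) * ((m.choose d : ℝ) - ((m - #K).choose d : ℝ)) := by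
  classical
  have h := sum_lowest_mul_choose (univ.filter fun a => x a = true) (d := d) (by rw [hxm]; exact hd)
    (fun D => if Disjoint D K then (0 : ℝ) else 1)
  rw [hxm] at h
  have lhs : (∑ σ : α ≃ Fin (Fintype.card α),
      (if Disjoint ((univ.filter fun a => x a = true).filter fun a =>
          #((univ.filter fun a => x a = true).filter fun c => σ c < σ a) < d) K then (0 : ℝ) else 1)) =
      #((univ : Finset (α ≃ Fin (Fintype.card α))).filter fun σ =>
        ¬ Disjoint ((univ.filter fun a => x a = true).filter fun a =>
            #((univ.filter fun a => x a = true).filter fun c => σ c < σ a) < d) K) := by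
    rw [Finset.sum_ite, sum_const_zero, zero_add, sum_const, nsmul_eq_mul, mul_one]
  set P := (univ.filter fun a => x a = true).powersetCard d with hP
  have rhs : ∑ D ∈ P, (if Disjoint D K then (0 : ℝ) else 1) = (m.choose d : ℝ) - ((m - #K).choose d : ℝ) := by
    have htot : (#P : ℝ) = (m.choose d : ℝ) := by
      rw [hP, card_powersetCard, hxm]
    have hgood : (#(P.filter fun D => Disjoint D K) : ℝ) = ((m - #K).choose d : ℝ) := by
      have : P.filter (fun D => Disjoint D K) = ((univ.filter fun a => x a = true) \ K).powersetCard d := by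
        ext D
        simp only [hP, mem_filter, mem_powersetCard, subset_sdiff, and_comm, and_left_comm]
      rw [this, card_powersetCard, card_sdiff_of_subset hK, hxm]
    rw [Finset.sum_ite, sum_const_zero, zero_add, sum_const, nsmul_eq_mul, mul_one]
    have hadd := Finset.card_filter_add_card_filter_not (s := P) (fun D => Disjoint D K)
    have hcast : (#(P.filter fun D => ¬ Disjoint D K) : ℝ) = (#P : ℝ) - #(P.filter fun D => Disjoint D K) := by
      rw [eq_sub_iff_add_eq, ← Nat.cast_add, add_comm, hadd]
    rw [hcast, htot, hgood]
  rw [← lhs, h, rhs]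

/-- **transport_counting** (registered helper sub-goal of stmt-PneNP-18026 for `stub_transport`,
part 2): the good part of the ranked-deletion transport, counted exactly
(`transport_counting_good`). [folklore] -/
theorem transport_counting :
    ∀ {α : Type*} [Fintype α] [DecidableEq α] (K : Finset α) (m d : ℕ), d ≤ m → ∀ F : (α → Bool) → ℝ, (∑ σ : α ≃ Fin (Fintype.card α), ∑ x ∈ (univ : Finset (α → Bool)).filter (fun x => #(univ.filter fun a => x a = true) = m ∧ K ⊆ univ.filter fun a => x a = true), (if Disjoint ((univ.filter fun a => x a = true).filter fun a => #((univ.filter fun a => x a = true).filter fun c => σ c < σ a) < d) K then F (fun a => x a && !decide (a ∈ (univ.filter fun a => x a = true).filter fun a => #((univ.filter fun a => x a = true).filter fun c => σ c < σ a) < d)) else 0)) * (m.choose d : ℝ) = (Fintype.card (α ≃ Fin (Fintype.card α)) : ℝ) * ((Fintype.card α - (m - d)).choose d : ℝ) * ∑ y ∈ (univ : Finset (α → Bool)).filter (fun y => #(univ.filter fun a => y a = true) = m - d ∧ K ⊆ univ.filter fun a => y a = true), F y :=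
  fun K _ _ hd F => transport_counting_good K hd F

end Summit.PneNP.PneNP.Theorems.MonotoneSuffices.SliceTransport
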